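/-
Copyright: the b2b-balaban cell (near-miss cell 7), T⁴-continuum fan-out, lineage t4-ne7b-p3 (node U5c LARGE-DEVIATION
member P3).  Released under the licence of the surrounding project.
-/
import Summits.QuantumFields.BalabanUV.T4Continuum.Support.SpaceTimeAssemblyLE
import Summits.QuantumFields.BalabanUV.T4Continuum.Support.SpaceTimeJunctionT

/-!
# Space-time Peierls ∕ Cramér route for NE7b — THE ASSEMBLY ON THE TAGGED LABEL: lineage readings over genealogies
# `Gen (ℕ × PEv)` read through the shape `Prod.snd` (`ConsistentTLE Prod.snd`, `dictWT`, `costT`, `credit ∘ Prod.snd`),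
# the pinned-contour bound from the pay inequalities, and the flow END — no `TypeNodup`, no `RenewAtReach`

Summits-side support leaf of the T⁴-continuum cell (rung (B)+1 on a FINITE torus only; NOT infinite volume, NOT the
mass gap, NOT the Clay statement; NOT a proof of the spine estimate NE7b).  Lineage `t4-ne7b-p3` (generation 3), node
U5c, skeleton `t4/skeletons/NE7b-t4-ne7b-p3.md` §14 (the TAGGED road).  [folklore] assembly: `SpaceTimeAssemblyLE` (the
LE road, this lineage) re-typed on the tagged label of `SpaceTimeTagged` ∕ `SpaceTimeJunctionT` (`tstep`, `tfat`), over
`SpaceTimeBankedRateLE` (`surplus_ge_rateB_of_bound`), `SpaceTimeVolume` (`volumeAccounting_ledgerOfGen`),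
`SpaceTimePinningK`, `SpaceTimeOccBridge`, `SpaceTimeThreshold`, the COUNT swarm's `HistoryBankingLE(Induction)`
(`ConsistentTLE`, `bankedLE_induction` for the shape map `Prod.snd`) and `Lit.T4TaggedShapeBanking`
(`dictWT`, `costT`, `exists_payThreshold`), `Lit.T4PrintedShapeBanking.one_le_R` — all BY NAME; nothing printed is
asserted; no `[cite:]` tag.

WHAT.
* §1 `stepsOK_of_consistentTLE_T`, `volumeAccounting_of_consistentTLE_T`, **`surplus_ge_rateB_T`**: the per-cell
  banked rate of a tagged genealogy `G : Gen (ℕ × PEv)` from `ConsistentTLE Prod.snd C K R G ∧ G.WF (dictWT Prod.snd R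
  C.n₁)`, valid constants, (2.9), `L ≥ 1`, sizes `R ≥ 1`, the pay inequalities and the volume accounting.
* §2 **`LineageReadingsT`** (the lineage data of every pinned contour is a TAGGED genealogy, admissible as
  `ConsistentTLE Prod.snd`, with the cell binder through `treeD tfat tstep` ∕ `treeSteps tstep` and the factorisation
  through `credits (credit C g ∘ Prod.snd) − lifeCost (dictWT Prod.snd R C.n₁) (costT Prod.snd C Kc R)`),
  **`pinnedContourBound_of_readingsT`**.
* §3 **`RunReadingsFlowT`**, `occLeaves_of_readingsT`, and THE END **`exists_irThresholdT_relWeightBound`** — same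
  statement shape as `exists_irThresholdLE_relWeightBound` with `RunReadingsFlowT` for `RunReadingsFlowLE`.

HONEST DEPENDENCY (cell, verbatim): continuum YM on T⁴ ⇐ BetaPertH ∧ nine spine estimates (0/9 proved); BetaPertH ⇐
(D1) ∧ (D4) ∧ CAP+tail; G-an2-4 gates asym, D1 and NE2/3/4.  This file changes none of it.
-/

open Finset

namespace Summit.QuantumFields.BalabanUV.T4Continuum.SpaceTimePeierls

open Literature.MathematicalPhysics.QuantumFieldTheory.Balaban1983to89
open T4WeightBudget T4StabilitySocket T4PersistenceDictionary T4BankedInduction T4PrintedShapeBanking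
open T4TaggedShapeBanking (dictWT costT exists_payThreshold dictWT_eq_comp)
open Summit.QuantumFields.BalabanUV.T4Continuum.HistoryBankingLE (ConsistentTLE)
open Summit.QuantumFields.BalabanUV.T4Continuum.HistoryBankingLEInduction (bankedLE_induction)
open SpaceTimePeierlsLeaves

noncomputable section

/-! ## §1 The banked rate of a tagged genealogy -/

section Rate

variable {C : T4PrintedShapeBanking.Consts} {K : ℕ} {R : ℕ → ℕ} {g : ℕ → ℝ} {L : ℕ} {β' β₀ : ℝ}

/-- `StepsOK` of a tagged genealogy from `ConsistentTLE Prod.snd ∧ Gen.WF`. [folklore] -/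
theorem stepsOK_of_consistentTLE_T :
    ∀ {G : Gen (ℕ × PEv)}, ConsistentTLE Prod.snd C K R G → G.WF (dictWT Prod.snd R C.n₁) →
      StepsOK tstep (dictWT Prod.snd R C.n₁) G
  | Gen.born _ _, _, _ => trivial
  | Gen.renew G e h, hc, hW => by
      simp only [ConsistentTLE] at hc
      obtain ⟨hG, -, -, hr, -⟩ := hc
      simp only [Gen.WF] at hW
      obtain ⟨hGW, -, hh, -⟩ := hW
      exact ⟨stepsOK_of_consistentTLE_T hG hGW, hh, hr⟩
  | Gen.merge X Y e, hc, hW => by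
      simp only [ConsistentTLE] at hc
      obtain ⟨hX, hY, -, hx, hx', hy, hy', -⟩ := hc
      simp only [Gen.WF] at hW
      obtain ⟨hXW, hYW, -⟩ := hW
      exact ⟨stepsOK_of_consistentTLE_T hX hXW, stepsOK_of_consistentTLE_T hY hYW, hx, hx', hy, hy'⟩

/-- the volume accounting of a tagged genealogy (`SpaceTimeVolume.volumeAccounting_ledgerOfGen`). [folklore] -/
theorem volumeAccounting_of_consistentTLE_T {cost : Gen (ℕ × PEv) → ℕ → ℝ} {credit : ℕ × PEv → ℝ} {cA cB dC : ℝ}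
    (hcA : 0 ≤ cA) (hcB : 0 ≤ cB) (hdC : 0 ≤ dC) {G : Gen (ℕ × PEv)} (hc : ConsistentTLE Prod.snd C K R G)
    (hW : G.WF (dictWT Prod.snd R C.n₁)) {t : ℕ} (ht : t ≤ G.reach (dictWT Prod.snd R C.n₁)) {vol : ℕ}
    (hvol : (vol : ℝ) ≤ cA * treeD tfat tstep dC G t + cB * treeSteps tstep G t) :
    (ledgerOfGen (dictWT Prod.snd R C.n₁) cost credit vol (fatSum tfat G) G).VolumeAccounting (2 * cA)
      (cB + 2 * cA * dC) :=
  volumeAccounting_ledgerOfGen hcA hcB hdC (stepsOK_of_consistentTLE_T hc hW) hW ht hvol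

/-- The root of an LE-consistent tagged genealogy is a birth at a performed step. [folklore] -/
theorem rootStep_le_of_consistentTLE_T {G : Gen (ℕ × PEv)} (hc : ConsistentTLE Prod.snd C K R G) : G.rootStep ≤ K := by
  classical
  have h := ConsistentTLE.step_le hc G.root G.root_mem
  rw [(ConsistentTLE.root_spec hc).2] at h
  exact h

/-- **THE BANKED RATE OF A TAGGED GENEALOGY** (the tagged form of `surplus_ge_rateB_LE`): from `ConsistentTLE Prod.snd
∧ Gen.WF (dictWT Prod.snd R C.n₁)`, valid constants, (2.9), `L ≥ 1`, sizes `R ≥ 1`, the pay inequalities at the cutoff,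
`0 ≤ A₀`, a nonnegative profile and the volume accounting:
`rateB κ₁ Eb μ C₁ C₂ · vol ≤ credits (credit C g ∘ Prod.snd) G − lifeCost (dictWT Prod.snd R C.n₁) (costT Prod.snd C K R) G`,
by the COUNT swarm's `bankedLE_induction` at the shape `Prod.snd`. [folklore] -/
theorem surplus_ge_rateB_T (hC : C.Valid) (h29 : B14FlowStep.FlowIneq29 R g L β' β₀ K) (hL : 1 ≤ L)
    (hR1 : ∀ s, s ≤ K → 1 ≤ R s) (hpay : PayIneqs C L K R g) (hA0 : 0 ≤ C.A₀)
    (hx0 : ∀ s, s ≤ K → 0 ≤ Real.log ((g s) ^ 2)⁻¹) {C₁ C₂ : ℝ} (hC₁ : 0 < C₁) (hC₂ : 0 < C₂)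
    {G : Gen (ℕ × PEv)} (hc : ConsistentTLE Prod.snd C K R G) (hW : G.WF (dictWT Prod.snd R C.n₁)) {vol : ℕ}
    (hvol : (ledgerOfGen (dictWT Prod.snd R C.n₁) (costT Prod.snd C K R) (credit C g ∘ Prod.snd) vol (fatSum tfat G)
      G).VolumeAccounting C₁ C₂) :
    rateB C.κ₁ C.Eb C.μ C₁ C₂ * vol ≤
      credits (credit C g ∘ Prod.snd) G - lifeCost (dictWT Prod.snd R C.n₁) (costT Prod.snd C K R) G := by
  obtain ⟨Hb, Hr, Hm⟩ := hpay
  have hind := bankedLE_induction hC h29 hL hR1 Hb Hr Hm hc (LateMergers.FreshT.of_wf _ hW)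
  -- the root reserve `2p₀(g_{rootStep})` is nonnegative
  have hroot := ConsistentTLE.root_spec hc
  have hres : 0 ≤ reserve C g (Prod.snd G.root) := by
    rw [reserve_kind0 hroot.1, hroot.2]
    unfold p0Profile
    exact mul_nonneg (by norm_num) (mul_nonneg hA0 (pow_nonneg (hx0 _ (rootStep_le_of_consistentTLE_T hc)) _))
  have hle : lifeCost (dictWT Prod.snd R C.n₁) (costT Prod.snd C K R) G +
      banks (fun e => C.κ₁ * ((dictWT Prod.snd R C.n₁ e : ℕ) : ℝ) + Emarg C (Prod.snd e)) G ≤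
        credits (credit C g ∘ Prod.snd) G := by
    linarith
  refine surplus_ge_rateB_of_bound (adm := ConsistentTLE (Prod.snd : ℕ × PEv → PEv) C K R) (fat := tfat)
    (E := fun e => Emarg C (Prod.snd e))
    (fun G e h hA => hA.1) (fun X Y e hA => ⟨hA.1, hA.2.1⟩) ?_ ?_ hC.κ₁_nonneg hC.Eb_nonneg hC.μ_nonneg hC₁ hC₂
    hc hW hle hvol
  · -- margins are nonnegative
    intro e
    by_cases h : (Prod.snd e).kind = 0
    · show 0 ≤ Emarg C (Prod.snd e)
      rw [Emarg_kind0 h]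
      have := hC.Eb_nonneg
      have := hC.μ_nonneg
      positivity
    · show 0 ≤ Emarg C (Prod.snd e)
      unfold Emarg
      rw [if_neg h]
      exact hC.E₀_nonneg
  · -- births: kind `0`, margin `Eb + μ(d′+1) ≥ Eb + μ d′`
    intro b j hb
    have hk : (Prod.snd b).kind = 0 := hb.1
    show C.Eb + C.μ * (tfat b : ℝ) ≤ Emarg C (Prod.snd b)
    rw [Emarg_kind0 hk]
    have : (tfat b : ℝ) = ((Prod.snd b).fat : ℝ) := rfl
    rw [this]
    nlinarith [hC.μ_nonneg]

end Rate

/-! ## §2 The lineage readings on the tagged label and the pinned-contour bound -/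

section OneRun

variable {ι : Type*} {Cell : Type} [Fintype Cell]

open Classical in
/-- **THE LINEAGE READINGS ON THE TAGGED LABEL** of ONE run at one `(K, t)` over an occupancy model `M`: as
`LineageReadingsLE`, with the genealogy of the pinned lineage a TAGGED genealogy `Gen (ℕ × PEv)` — admissible as
`ConsistentTLE Prod.snd`, well formed for `dictWT Prod.snd`, its cell binder through `treeD tfat tstep` ∕
`treeSteps tstep`, its banked factor through the shape `Prod.snd`.  Every event has its own label: NO `TypeNodup`.
A hypothesis shape; nothing asserted. [folklore] -/
structure LineageReadingsT (M : OccModel ι Cell) [DecidableRel M.Adj.Adj] (C : T4PrintedShapeBanking.Consts)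
    (K Kc : ℕ) (R : ℕ → ℕ) (g : ℕ → ℝ) (A : ι → ℝ) (Bad : Finset ι) (jlo : ℕ) (nup : ℝ) (Δ : ℕ)
    (Δ₁ Nanc cA cB dC c₃ : ℝ) : Prop where
  /-- entropy: degree bound of the space-time adjacency -/
  deg : ∀ c, M.Adj.degree c ≤ Δ
  /-- entropy: site animals (leaf A1) -/
  animal : SiteAnimalBound Δ Δ₁
  /-- entropy: the anchors (cells of the final scale `K`) -/
  anchors : (((univ : Finset Cell).filter fun c => M.scale c = K).card : ℝ) ≤ Nanc
  /-- I-2: nonnegative weights -/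
  nonneg : ∀ τ ∈ M.T, 0 ≤ A τ
  /-- A2c: every bad term has a contour meeting every scale of `[jlo, K]` -/
  cover : M.ContourCover Bad jlo K
  /-- A2b ∕ (ID) ∕ A3a ∕ A3e ∕ A3f: the tagged lineage data of every pinned contour -/
  lineage : ∃ (gen : ι → Finset Cell → Gen (ℕ × PEv)) (rest : Finset Cell → ι → ℝ) (tcut : ι → Finset Cell → ℕ),
    (∀ (𝒦 : Finset Cell), ∀ τ ∈ M.T, M.IsContour τ 𝒦 →
        ConsistentTLE Prod.snd C Kc R (gen τ 𝒦) ∧ (gen τ 𝒦).WF (dictWT Prod.snd R C.n₁) ∧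
        tcut τ 𝒦 ≤ (gen τ 𝒦).reach (dictWT Prod.snd R C.n₁) ∧
        (𝒦.card : ℝ) ≤ cA * treeD tfat tstep dC (gen τ 𝒦) (tcut τ 𝒦) + cB * treeSteps tstep (gen τ 𝒦) (tcut τ 𝒦) ∧
        A τ ≤ Real.exp (-(credits (credit C g ∘ Prod.snd) (gen τ 𝒦) -
          lifeCost (dictWT Prod.snd R C.n₁) (costT Prod.snd C Kc R) (gen τ 𝒦))) * rest 𝒦 τ) ∧
    (∀ (𝒦 : Finset Cell), ∀ τ ∈ M.T, 0 ≤ rest 𝒦 τ) ∧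
    (∀ (𝒦 : Finset Cell), ∑ τ ∈ M.T.filter (fun τ => M.IsContour τ 𝒦), rest 𝒦 τ ≤ Real.exp c₃ ^ 𝒦.card * nup)

variable {M : OccModel ι Cell} [DecidableRel M.Adj.Adj] {C : T4PrintedShapeBanking.Consts} {K Kc : ℕ} {R : ℕ → ℕ}
  {g : ℕ → ℝ} {A : ι → ℝ} {Bad : Finset ι} {jlo : ℕ} {nup : ℝ} {Δ : ℕ} {Δ₁ Nanc cA cB dC c₃ : ℝ}

/-- **LEAF A3 ON THE TAGGED LABEL.**  The tagged lineage readings, valid constants with `0 ≤ A₀`, a nonnegative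
profile, (2.9), `L ≥ 1`, sizes `R ≥ 1`, the pay inequalities and positive cell constants give the PINNED-CONTOUR
BOUND with price `e^{−(rateB − c₃)}`. [folklore] -/
theorem pinnedContourBound_of_readingsT {L : ℕ} {β' β₀ : ℝ}
    (h : LineageReadingsT M C K Kc R g A Bad jlo nup Δ Δ₁ Nanc cA cB dC c₃) (hC : C.Valid) (hA0 : 0 ≤ C.A₀)
    (hx0 : ∀ s, s ≤ Kc → 0 ≤ Real.log ((g s) ^ 2)⁻¹) (h29 : B14FlowStep.FlowIneq29 R g L β' β₀ Kc) (hL : 1 ≤ L)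
    (hR1 : ∀ s, s ≤ Kc → 1 ≤ R s) (hpay : PayIneqs C L Kc R g) (hcA : 0 < cA) (hcB : 0 < cB) (hdC : 0 ≤ dC) :
    M.PinnedContourBound A (Real.exp (-(rateB C.κ₁ C.Eb C.μ (2 * cA) (cB + 2 * cA * dC) - c₃))) nup := by
  classical
  obtain ⟨gen, rest, tcut, hlin, hrest, hrem⟩ := h.lineage
  have hC₁ : 0 < 2 * cA := by positivity
  have hC₂ : 0 < cB + 2 * cA * dC := by positivity
  have hfac := factor_of_surplusK (M := M) (A := A) (rest := rest)
    (S := fun 𝒦 τ => credits (credit C g ∘ Prod.snd) (gen τ 𝒦) -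
      lifeCost (dictWT Prod.snd R C.n₁) (costT Prod.snd C Kc R) (gen τ 𝒦))
    (s := rateB C.κ₁ C.Eb C.μ (2 * cA) (cB + 2 * cA * dC)) hrest
    (fun 𝒦 τ hτ hc => (hlin 𝒦 τ hτ hc).2.2.2.2)
    (fun 𝒦 τ hτ hc => by
      obtain ⟨hcons, hwf, hcut, hcells, -⟩ := hlin 𝒦 τ hτ hc
      exact surplus_ge_rateB_T hC h29 hL hR1 hpay hA0 hx0 hC₁ hC₂ hcons hwf
        (volumeAccounting_of_consistentTLE_T (cost := costT Prod.snd C Kc R) (credit := credit C g ∘ Prod.snd) hcA.le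
          hcB.le hdC hcons hwf hcut hcells))
  have hsplit : M.PinnedSplitK A rest (Real.exp (-rateB C.κ₁ C.Eb C.μ (2 * cA) (cB + 2 * cA * dC)))
      (Real.exp c₃) nup :=
    ⟨hrest, hfac, hrem⟩
  have key := OccModel.pinnedContourBound_of_splitK hsplit (Real.exp_nonneg _)
  have hq : Real.exp (-rateB C.κ₁ C.Eb C.μ (2 * cA) (cB + 2 * cA * dC)) * Real.exp c₃ =
      Real.exp (-(rateB C.κ₁ C.Eb C.μ (2 * cA) (cB + 2 * cA * dC) - c₃)) := by
    rw [← Real.exp_add]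
    congr 1
    ring
  rw [hq] at key
  exact key

end OneRun

/-! ## §3 The flow END on the tagged label -/

section Flow

variable {ι : Type*} [DecidableEq ι]

/-- NAMED SHAPE `RunReadingsFlowT …` (ONE run, ONE `(K, t)`): as `RunReadingsFlowLE` with the TAGGED lineage readings.
A hypothesis shape; nothing asserted. [folklore] -/
def RunReadingsFlowT (C : T4PrintedShapeBanking.Consts) (L r : ℕ) (β₀ x₀ : ℝ) (T : ℕ → Finset ι)
    (X : ℕ → ℝ → ι → ℝ) (Bad : ℕ → ℝ → Finset ι) (xup : ℕ → ℝ → ℝ) (jstar : ℕ → ℕ) (Δ₁ Nanc cA cB dC c₃ : ℝ)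
    (K : ℕ) (t : ℝ) : Prop :=
  ∃ (Cell : Type) (_ : Fintype Cell) (_ : DecidableEq Cell) (M : OccModel ι Cell) (_ : DecidableRel M.Adj.Adj)
    (Δ Kc : ℕ) (R : ℕ → ℕ) (g : ℕ → ℝ) (β' : ℝ),
    M.T = T K ∧ B14.FlowIneq27 g β' β₀ C.p₀ Kc ∧ B14FlowStep.FlowIneq29 R g L β' β₀ Kc ∧
    (∀ s, s ≤ Kc → B14.IsRj L r (g s) (R s)) ∧ (∀ s, s ≤ Kc → 1 ≤ Real.log ((g s) ^ 2)⁻¹) ∧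
    x₀ ≤ Real.log ((g Kc) ^ 2)⁻¹ ∧
    LineageReadingsT M C K Kc R g (X K t) (Bad K t) (jstar K) (xup K t) Δ Δ₁ Nanc cA cB dC c₃

omit [DecidableEq ι] in
/-- the tagged readings of a run with its pay inequalities give its `OccLeaves`. [folklore] -/
theorem occLeaves_of_readingsT {C : T4PrintedShapeBanking.Consts} (hC : C.Valid) (hA0 : 0 ≤ C.A₀) {L : ℕ}
    (hL : 1 ≤ L) {Δ₁ Nanc cA cB dC c₃ : ℝ} (hcA : 0 < cA) (hcB : 0 < cB) (hdC : 0 ≤ dC) {T : ℕ → Finset ι}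
    {X : ℕ → ℝ → ι → ℝ} {Bad : ℕ → ℝ → Finset ι} {xup : ℕ → ℝ → ℝ} {jstar : ℕ → ℕ} {K : ℕ} {t : ℝ}
    {Cell : Type} [Fintype Cell] [DecidableEq Cell] {M : OccModel ι Cell} [DecidableRel M.Adj.Adj] {Δ Kc : ℕ}
    {R : ℕ → ℕ} {g : ℕ → ℝ} {β' β₀ : ℝ} {r : ℕ} (hT : M.T = T K) (h29 : B14FlowStep.FlowIneq29 R g L β' β₀ Kc)
    (hRj : ∀ s, s ≤ Kc → B14.IsRj L r (g s) (R s)) (hx1 : ∀ s, s ≤ Kc → 1 ≤ Real.log ((g s) ^ 2)⁻¹)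
    (hpay : PayIneqs C L Kc R g)
    (hLT : LineageReadingsT M C K Kc R g (X K t) (Bad K t) (jstar K) (xup K t) Δ Δ₁ Nanc cA cB dC c₃) :
    OccLeaves T X Bad xup jstar Nanc Δ₁ (rateB C.κ₁ C.Eb C.μ (2 * cA) (cB + 2 * cA * dC) - c₃) K t := by
  refine ⟨Cell, inferInstance, inferInstance, M, inferInstance, Δ, hT, hLT.deg, hLT.animal, hLT.anchors, hLT.cover,
    ?_, ?_⟩
  · exact pinnedContourBound_of_readingsT hLT hC hA0 (fun s hs => by linarith [hx1 s hs]) h29 hL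
      (one_le_R hRj hL) hpay hcA hcB hdC
  · intro τ hτ
    exact hLT.nonneg τ (hT ▸ hτ)

/-- **THE END OF THE CONTOUR ROUTE ON THE TAGGED LABEL — ONE INFRARED THRESHOLD, SURVIVAL AUTOMATIC, EVERY HISTORY
ADMITTED (no `TypeNodup`, no `RenewAtReach`).**  Statement shape = `exists_irThresholdLE_relWeightBound` with
`RunReadingsFlowT` for `RunReadingsFlowLE`. [folklore] -/
theorem exists_irThresholdT_relWeightBound (C₀ : T4PrintedShapeBanking.Consts) (hC₀ : C₀.Valid) (ha : 0 < C₀.a)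
    (hA : 0 < C₀.A₀) {L r : ℕ} (hL : 1 ≤ L) {β₀ : ℝ} (hβ : 0 ≤ β₀) (hrq : r * (C₀.q' + 1) < C₀.p₀)
    {Δ₁ cA cB dC : ℝ} (hΔ₁ : 0 < Δ₁) (hcA : 0 < cA) (hcB : 0 < cB) (hdC : 0 ≤ dC) (c₃ : ℝ) :
    ∃ x₀ : ℝ, ∀ (l₀ : ℝ) (T : ℕ → Finset ι) (A B : ℕ → ℝ → ι → ℝ) (Bad : ℕ → ℝ → Finset ι)
      (nup mup nlow mlow : ℕ → ℝ → ℝ) (Cst : ℝ) (K₀ : ℕ) (jstar : ℕ → ℕ) (Nanc c : ℝ),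
      (∀ K t, |t| ≤ l₀ → K₀ ≤ K → RunReadingsFlowT (withBanks C₀ (survivalRate Δ₁ c₃) (2 * cA) (cB + 2 * cA * dC))
        L r β₀ x₀ T A Bad nup jstar Δ₁ Nanc cA cB dC c₃ K t) →
      (∀ K t, |t| ≤ l₀ → K₀ ≤ K → RunReadingsFlowT (withBanks C₀ (survivalRate Δ₁ c₃) (2 * cA) (cB + 2 * cA * dC))
        L r β₀ x₀ T B Bad mup jstar Δ₁ Nanc cA cB dC c₃ K t) →
      LowEnvelope l₀ T A nlow nup Cst K₀ → LowEnvelope l₀ T B mlow mup Cst K₀ → 0 ≤ Cst →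
      (∀ K, jstar K ≤ K) → 0 ≤ Nanc → 0 < c → (∀ K : ℕ, c * K ≤ ((K - jstar K : ℕ) : ℝ)) →
      ∃ K₁, K₀ ≤ K₁ ∧ RelWeightBound l₀ T A B (fun K t => if K₁ ≤ K then Bad K t else ∅)
        (Set.indicator {K | K₁ ≤ K} (fun K => Cst *
          contourBudget Nanc (Δ₁ * Real.exp (-(survivalRate Δ₁ c₃ - c₃))) jstar K)) := by
  have hC₁ : 0 < 2 * cA := by positivity
  have hC₂ : 0 < cB + 2 * cA * dC := by positivity
  set C := withBanks C₀ (survivalRate Δ₁ c₃) (2 * cA) (cB + 2 * cA * dC) with hC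
  have hV : C.Valid := withBanks_valid hC₀ (survivalRate_nonneg Δ₁ c₃) hC₁.le hC₂.le
  have hrate : rateB C.κ₁ C.Eb C.μ (2 * cA) (cB + 2 * cA * dC) = survivalRate Δ₁ c₃ := rateB_withBanks hC₁ hC₂
  have hA0 : 0 ≤ C.A₀ := hA.le
  obtain ⟨x₀, hx₀⟩ := exists_payThreshold C hV ha hA hL hβ hrq
  refine ⟨x₀, ?_⟩
  intro l₀ T A B Bad nup mup nlow mlow Cst K₀ jstar Nanc c hRA hRB hEA hEB hCst hj hNanc hc hfrac
  have toLeaves : ∀ {X : ℕ → ℝ → ι → ℝ} {xup : ℕ → ℝ → ℝ} {K : ℕ} {t : ℝ},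
      RunReadingsFlowT C L r β₀ x₀ T X Bad xup jstar Δ₁ Nanc cA cB dC c₃ K t →
        OccLeaves T X Bad xup jstar Nanc Δ₁ (rateB C.κ₁ C.Eb C.μ (2 * cA) (cB + 2 * cA * dC) - c₃) K t := by
    intro X xup K t h
    obtain ⟨Cell, hF, hD, M, hR, Δ, Kc, R, g, β', hT, h27, h29, hRj, hx1, hxK, hL'⟩ := h
    exact occLeaves_of_readingsT hV hA0 hL hcA hcB hdC hT h29 hRj hx1 (hx₀ Kc R g β' h27 hRj hx1 hxK) hL'
  have key := exists_relWeightBound_of_occLeaves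
    (fun K t ht hK => toLeaves (hRA K t ht hK)) (fun K t ht hK => toLeaves (hRB K t ht hK))
    hEA hEB hCst hj hNanc hΔ₁ (by rw [hrate]; exact survives_of_lt hΔ₁ (lt_survivalRate Δ₁ c₃)) hc hfrac
  rw [hrate] at key
  exact key

end Flow

end

end Summit.QuantumFields.BalabanUV.T4Continuum.SpaceTimePeierls
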